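import Summits.AtomisticToContinuum.Crystallization.Theses.NashClassCertificates

/-!
# Crux `NashTwoShellGap` (stmt-AtomisticToContinuum-16826), line `birth`: Nash ⇒ force balance

What the Nash (best-response) hypothesis of the crux hands to the certificate tier of the
hardest stub `stub_jammedBadGap` (the route's intended proof uses multipliers `μ_i · F_i`): every
particle of a separated Nash Lennard-Jones configuration is FORCE-BALANCED,

  `F_i := ∑_{j ≠ i} (r_ij⁻⁸ − r_ij⁻¹⁴) (x_i − x_j) = 0`,   `r_ij = |x_i − x_j|`,

i.e. `∑_{j ≠ i} V′(r_ij) (x_i − x_j)/r_ij = 0` with `V = r⁻¹²/12 − r⁻⁶/6`, `V′(r)/r = r⁻⁸ − r⁻¹⁴`.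
Proof: the relocation energy `t ↦ ∑_{j ≠ i} V(|x_i + t v − x_j|)` has a local minimum at `t = 0`
(nearby points are free by separation, and Nash compares), it is differentiable there with
derivative `⟪F_i, v⟫` (chain rule through `V(‖w‖) = W(‖w‖²)`, `W(s) = s⁻⁶/12 − s⁻³/6`), so
Fermat gives `⟪F_i, v⟫ = 0` for every `v`, whence `F_i = 0`.  No definitions; `[folklore]`.
-/

noncomputable section

namespace Summit.AtomisticToContinuum.Crystallization.Theorems.NashTwoShellGapForceBalance

open scoped BigOperators Classical RealInnerProductSpace
open Literature.MathematicalPhysics.StatisticalMechanics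

/-- `V_LJ(‖w‖) = W(‖w‖²)` with `W(s) = (1/12) s⁻⁶ − (1/6) s⁻³`. [folklore] -/
theorem lennardJones_norm_eq (w : EuclideanSpace ℝ (Fin 3)) :
    lennardJones ‖w‖ = (1 / 12) * ((‖w‖ ^ 2)⁻¹) ^ 6 - (1 / 6) * ((‖w‖ ^ 2)⁻¹) ^ 3 := by
  simp only [lennardJones, inv_pow, ← pow_mul]

/-- The radial profile `W(s) = (1/12) s⁻⁶ − (1/6) s⁻³` has derivative
`−(1/2) s⁻⁷ + (1/2) s⁻⁴` at every `s ≠ 0`. [folklore] -/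
theorem hasDerivAt_profile {s : ℝ} (hs : s ≠ 0) :
    HasDerivAt (fun u : ℝ => (1 / 12) * (u⁻¹) ^ 6 - (1 / 6) * (u⁻¹) ^ 3)
      (-(1 / 2) * (s⁻¹) ^ 7 + (1 / 2) * (s⁻¹) ^ 4) s := by
  have h1 : HasDerivAt (fun u : ℝ => u⁻¹) (-(s ^ 2)⁻¹) s := hasDerivAt_inv hs
  have h6 := (h1.fun_pow 6).const_mul (1 / 12 : ℝ)
  have h3 := (h1.fun_pow 3).const_mul (1 / 6 : ℝ)
  have h := h6.fun_sub h3
  refine h.congr_deriv ?_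
  rw [inv_pow s 2]
  push_cast
  ring

/-- The squared distance along a line: `‖d + t v‖² = ‖d‖² + 2t⟪d, v⟫ + t²‖v‖²`. [folklore] -/
theorem norm_add_smul_sq (d v : EuclideanSpace ℝ (Fin 3)) (t : ℝ) :
    ‖d + t • v‖ ^ 2 = ‖d‖ ^ 2 + 2 * t * ⟪d, v⟫ + t ^ 2 * ‖v‖ ^ 2 := by
  rw [norm_add_sq_real, real_inner_smul_right, norm_smul, mul_pow, Real.norm_eq_abs, sq_abs]
  ring

/-- Its derivative at `t = 0` is `2⟪d, v⟫`. [folklore] -/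
theorem hasDerivAt_norm_add_smul_sq (d v : EuclideanSpace ℝ (Fin 3)) :
    HasDerivAt (fun t : ℝ => ‖d + t • v‖ ^ 2) (2 * ⟪d, v⟫) 0 := by
  have h1 : HasDerivAt (fun t : ℝ => ‖d‖ ^ 2 + 2 * t * ⟪d, v⟫ + t ^ 2 * ‖v‖ ^ 2)
      (0 + 2 * 1 * ⟪d, v⟫ + ((2 : ℕ) * (id (0 : ℝ)) ^ (2 - 1) * 1) * ‖v‖ ^ 2) 0 := by
    refine ((hasDerivAt_const _ _).fun_add ?_).fun_add ?_
    · exact ((hasDerivAt_id (0 : ℝ)).const_mul 2).mul_const _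
    · exact ((hasDerivAt_id (0 : ℝ)).fun_pow 2).mul_const _
  have h2 : (fun t : ℝ => ‖d + t • v‖ ^ 2) = fun t : ℝ => ‖d‖ ^ 2 + 2 * t * ⟪d, v⟫ + t ^ 2 * ‖v‖ ^ 2 :=
    funext fun t => norm_add_smul_sq d v t
  rw [h2]
  refine h1.congr_deriv ?_
  simp

/-- **Derivative of one pair term along a relocation line.** For `d = x_i − x_j ≠ 0`,
`t ↦ V_LJ(‖d + t v‖)` has derivative `(‖d‖⁻⁸ − ‖d‖⁻¹⁴) ⟪d, v⟫` at `t = 0`. [folklore] -/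
theorem hasDerivAt_lennardJones_line (d v : EuclideanSpace ℝ (Fin 3)) (hd : d ≠ 0) :
    HasDerivAt (fun t : ℝ => lennardJones ‖d + t • v‖)
      (((‖d‖⁻¹) ^ 8 - (‖d‖⁻¹) ^ 14) * ⟪d, v⟫) 0 := by
  have hd2 : ‖d‖ ^ 2 ≠ 0 := pow_ne_zero 2 (norm_ne_zero_iff.2 hd)
  have hq := hasDerivAt_norm_add_smul_sq d v
  have h0 : (fun t : ℝ => ‖d + t • v‖ ^ 2) 0 = ‖d‖ ^ 2 := by simp
  have hW : HasDerivAt (fun u : ℝ => (1 / 12) * (u⁻¹) ^ 6 - (1 / 6) * (u⁻¹) ^ 3)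
      (-(1 / 2) * ((‖d‖ ^ 2)⁻¹) ^ 7 + (1 / 2) * ((‖d‖ ^ 2)⁻¹) ^ 4)
      ((fun t : ℝ => ‖d + t • v‖ ^ 2) 0) := by
    rw [h0]
    exact hasDerivAt_profile hd2
  have hc := hW.comp 0 hq
  have hfun : (fun t : ℝ => lennardJones ‖d + t • v‖) =
      (fun u : ℝ => (1 / 12) * (u⁻¹) ^ 6 - (1 / 6) * (u⁻¹) ^ 3) ∘ fun t : ℝ => ‖d + t • v‖ ^ 2 := by
    funext t
    simp only [Function.comp, lennardJones_norm_eq]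
  rw [hfun]
  refine hc.congr_deriv ?_
  rw [inv_pow (‖d‖) 8, inv_pow (‖d‖) 14, inv_pow (‖d‖ ^ 2) 7, inv_pow (‖d‖ ^ 2) 4, ← pow_mul,
    ← pow_mul]
  norm_num
  ring

/-- **Registered sub-goal `stub_nashForceBalance`** (lead, line `birth`): every particle of a
`1/3`-separated Nash Lennard-Jones configuration is force-balanced,
`∑_{j ≠ i} (r_ij⁻⁸ − r_ij⁻¹⁴) • (x_i − x_j) = 0` (`= ∑_{j ≠ i} V′(r_ij)(x_i − x_j)/r_ij`).
Fermat's theorem for the relocation energy `t ↦ ∑_{j ≠ i} V(|x_i + t v − x_j|)`, which the Nash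
hypothesis makes locally minimal at `t = 0` (points near `x_i` are free by separation).
[folklore] -/
theorem stub_nashForceBalance : ∀ (N : ℕ) (x : Fin N → EuclideanSpace ℝ (Fin 3)), (∀ i j : Fin N, i ≠ j → 1 / 3 ≤ dist (x i) (x j)) → (∀ (i : Fin N) (y : EuclideanSpace ℝ (Fin 3)), (∀ j : Fin N, j ≠ i → y ≠ x j) → Literature.MathematicalPhysics.StatisticalMechanics.siteEnergy Literature.MathematicalPhysics.StatisticalMechanics.lennardJones x i ≤ ∑ j ∈ Finset.univ.erase i, Literature.MathematicalPhysics.StatisticalMechanics.lennardJones (dist y (x j))) → ∀ i : Fin N, ∑ j ∈ Finset.univ.erase i, ((dist (x i) (x j))⁻¹ ^ 8 - (dist (x i) (x j))⁻¹ ^ 14) • (x i - x j) = 0 := by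
  intro N x hsep hnash i
  set F : EuclideanSpace ℝ (Fin 3) :=
    ∑ j ∈ Finset.univ.erase i, ((dist (x i) (x j))⁻¹ ^ 8 - (dist (x i) (x j))⁻¹ ^ 14) • (x i - x j)
    with hF
  -- ⟪F, v⟫ = 0 for every direction v
  have hinner : ∀ v : EuclideanSpace ℝ (Fin 3), ⟪F, v⟫ = 0 := by
    intro v
    -- the relocation energy along the line through x i in direction v
    set g : ℝ → ℝ := fun t => ∑ j ∈ Finset.univ.erase i, lennardJones (dist (x i + t • v) (x j))
      with hg
    -- (1) derivative at 0
    have hderiv : HasDerivAt g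
        (∑ j ∈ Finset.univ.erase i, ((dist (x i) (x j))⁻¹ ^ 8 - (dist (x i) (x j))⁻¹ ^ 14) * ⟪x i - x j, v⟫) 0 := by
      rw [hg]
      apply HasDerivAt.fun_sum
      intro j hj
      have hji : j ≠ i := Finset.ne_of_mem_erase hj
      have hd : x i - x j ≠ 0 := by
        intro h0
        have h13 := hsep i j hji.symm
        rw [dist_eq_norm, h0, norm_zero] at h13
        norm_num at h13
      have key := hasDerivAt_lennardJones_line (x i - x j) v hd
      have hfun : (fun t : ℝ => lennardJones (dist (x i + t • v) (x j))) =
          fun t : ℝ => lennardJones ‖x i - x j + t • v‖ := by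
        funext t
        rw [dist_eq_norm, add_sub_right_comm]
      rw [hfun, dist_eq_norm]
      exact key
    -- (2) local minimality at 0 from the Nash hypothesis (nearby points are free)
    have hmin : IsLocalMin g 0 := by
      have hε : (0 : ℝ) < 1 / (3 * (‖v‖ + 1)) := by positivity
      refine Filter.Eventually.mono (Metric.ball_mem_nhds (0 : ℝ) hε) fun t ht => ?_
      replace ht : |t| < 1 / (3 * (‖v‖ + 1)) := by simpa [Real.dist_eq] using ht
      have htv : ‖t • v‖ < 1 / 3 := by
        rw [norm_smul, Real.norm_eq_abs]
        have hv0 : 0 ≤ ‖v‖ := norm_nonneg v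
        have hv1 : 0 < ‖v‖ + 1 := by positivity
        calc |t| * ‖v‖ ≤ 1 / (3 * (‖v‖ + 1)) * ‖v‖ := mul_le_mul_of_nonneg_right ht.le hv0
          _ < 1 / (3 * (‖v‖ + 1)) * (‖v‖ + 1) := mul_lt_mul_of_pos_left (by linarith) hε
          _ = 1 / 3 := by field_simp
      have hfree : ∀ j : Fin N, j ≠ i → x i + t • v ≠ x j := by
        intro j hji h0
        have h13 := hsep i j hji.symm
        have hd : dist (x i) (x j) = ‖t • v‖ := by
          rw [← h0, dist_eq_norm, sub_add_cancel_left, norm_neg]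
        linarith
      have h := hnash i (x i + t • v) hfree
      have hg0 : g 0 = siteEnergy lennardJones x i := by
        simp only [hg, zero_smul, add_zero, siteEnergy]
      rw [hg0]
      exact h
    -- (3) Fermat
    have hzero := hmin.hasDerivAt_eq_zero hderiv
    rw [hF, sum_inner]
    simp only [real_inner_smul_left]
    exact hzero
  exact inner_self_eq_zero.1 (hinner F)

end Summit.AtomisticToContinuum.Crystallization.Theorems.NashTwoShellGapForceBalance

end
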